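import Summits.CriticalPhenomena.PercolationContinuityZ3.Theorems.PercNearOneGluingNoHeavyQuantLightPairBlobForest
import HarnessLib

/-!
# QUANT lane R8, T-DEC: THE CORNER LAW IS A MEMBER JUST BELOW ITS NATURAL FLOOR — an explicit five-column certificate for
# `(R¹[3/5](R⁴[49/60]))² = lpT 4 (3/5) (49/60)` (natural floor `49/100`, mean `128/25`, top `10`) at the floor `12/25`

builds on p205010 (kernel theorem, internal audit signed; external expert review pending)

Support file (`--supports stmt-CriticalPhenomena-4575`), QUANT lane census seat prim-quant-census-2 (gen 77), rung R8 of
`run/shared/lean/prim/quant/LADDER.md`.  Theorems only; standard axioms, no sorries, no `native_decide` (closed rational arithmetic by `norm_num`).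

WHAT.  Census-2 g77 (memo `run/shared/lean/prim/quant/prim-quant-census-2-g77/CENSUS-PAIRMAP-G77.md` §4) finds the light glued pair
`T = (R¹[3/5](R⁴[49/60]))²` OUT of the free gated-caterpillar hull AT its natural floor `49/100` (g75 engine, B&B-certified for the tiers BB ∪ CAT2 ∪ CAT3;
exhaustive vocabulary running) — the instance (P) `CatPairLight` predicts IN (`lpT_inGatedCatHull_of_catPairLight_ex`, ✓ `…QuantLightPairTreeBuilt`) — and
IN at the floors `12/25` and `47/100`.  This file is the KERNEL anchor of the IN side: the exact certificate found by g77's own dictionary LP at floor `12/25`,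
  `T = w₁·gate_{16/25}(δ₂ ∗ blob(8, 3/4)) + w₂·[blob(5, 12/25) ∗ blob(5, 68/125)] + w₃·[blob(1, 12/25) ∗ δ₁ ∗ blob(4, 91/100)]`
  `  + w₄·[blob(5, 12/25) ∗ gate_{136/175}(δ₁ ∗ blob(4, 5/8))] + w₅·[δ₂ ∗ gate_{7/8}(δ₃ ∗ blob(1, 99/175))]`,
  `(w₁, …, w₅) = (1789/33024, 1158685/3649152, 6259/107328, 4106641/7298304, 49/6708)`
(three blob forests — one under the outer gate `16/25` — and two depth-2 caterpillars; four gates floor-tight: `3/4 = (12/25)/(16/25)`, `12/25` twice,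
`99/175 ≥ 96/175 = (12/25)/(7/8)`, `5/8 ≥ 21/34 = (12/25)/(136/175)`).
* `cornerLaw_inGatedCatHull : InGatedCatHull (12/25) (128/25) 10 (lpT 4 (3/5) (49/60))`, `sdec_cornerLaw`, and the node's instances at floors `≤ 12/25`
  (`treeBuiltCatHull_cornerLaw`).  The strip of floors `(12/25, 49/100)` is where the census says the node `TreeBuiltCatHullLight` fails for this law.
HONEST STATUS.  One instance; `TreeBuiltCatHullLight`, `CatPairLight` (under adverse census at this corner), `SiblingStep`, `FarTreeRow` remain OPEN; RATE
class log\* / honest sentence of `run/shared/lean/prim/quant/README.md` unchanged.  [this work].  Nothing here is cited as a published result.  The gluing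
rows served [cite: KozmaNitzan2024, Conjecture 3 (p. 15)]; product measure [cite: Grimmett1999, §1.3 p. 10].
-/

noncomputable section

open scoped BigOperators

namespace Summit.CriticalPhenomena.PercolationContinuityZ3.Theorems
namespace Quant
namespace LawDec

open Finset

/-! ### Value forms of slices of short point-mass combinations -/

/-- slicing a two-term point-mass combination. [folklore] -/
theorem slice_apply_lin2 (c₁ c₂ : ℝ) (n₁ n₂ a : ℕ) (g : ℝ) (h : ℕ) :
    slice (fun k => c₁ * pointLaw n₁ k + c₂ * pointLaw n₂ k) a g h =
      (1 - g) * (c₁ * pointLaw n₁ h + c₂ * pointLaw n₂ h) + g * (c₁ * pointLaw (a + n₁) h + c₂ * pointLaw (a + n₂) h) := by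
  simp only [slice]
  rw [show (if a ≤ h then c₁ * pointLaw n₁ (h - a) + c₂ * pointLaw n₂ (h - a) else 0) =
      c₁ * (if a ≤ h then pointLaw n₁ (h - a) else 0) + c₂ * (if a ≤ h then pointLaw n₂ (h - a) else 0) by split_ifs <;> ring,
    halfPt_shift, halfPt_shift]

/-- slicing a three-term point-mass combination. [folklore] -/
theorem slice_apply_lin3 (c₁ c₂ c₃ : ℝ) (n₁ n₂ n₃ a : ℕ) (g : ℝ) (h : ℕ) :
    slice (fun k => c₁ * pointLaw n₁ k + c₂ * pointLaw n₂ k + c₃ * pointLaw n₃ k) a g h =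
      (1 - g) * (c₁ * pointLaw n₁ h + c₂ * pointLaw n₂ h + c₃ * pointLaw n₃ h) +
        g * (c₁ * pointLaw (a + n₁) h + c₂ * pointLaw (a + n₂) h + c₃ * pointLaw (a + n₃) h) := by
  simp only [slice]
  rw [show (if a ≤ h then c₁ * pointLaw n₁ (h - a) + c₂ * pointLaw n₂ (h - a) + c₃ * pointLaw n₃ (h - a) else 0) =
      c₁ * (if a ≤ h then pointLaw n₁ (h - a) else 0) + c₂ * (if a ≤ h then pointLaw n₂ (h - a) else 0) +
        c₃ * (if a ≤ h then pointLaw n₃ (h - a) else 0) by split_ifs <;> ring,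
    halfPt_shift, halfPt_shift, halfPt_shift]

/-! ### The five columns: value forms -/

/-- column 1: `gate_{16/25}(δ₂ ∗ blob(8, 3/4))`. [this work] -/
theorem cw1_apply (h : ℕ) : gate (blobLaw [(8, (3 : ℝ) / 4), (2, 1)]) ((16 : ℝ) / 25) h =
    (9 : ℝ) / 25 * pointLaw 0 h + (4 : ℝ) / 25 * pointLaw 2 h + (12 : ℝ) / 25 * pointLaw 10 h := by
  rw [gate_apply, blobLaw_pair_sure_apply, show (if h = 0 then (1 : ℝ) else 0) = pointLaw 0 h from (pointLaw_apply 0 h).symm]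
  ring

/-- column 2: `blob(5, 12/25) ∗ blob(5, 68/125)` = `blobLaw [(5, 12/25), (5, 68/125)]`. [this work] -/
theorem cw2_apply (h : ℕ) : blobLaw [(5, (12 : ℝ) / 25), (5, (68 : ℝ) / 125)] h =
    (741 : ℝ) / 3125 * pointLaw 0 h + (1568 : ℝ) / 3125 * pointLaw 5 h + (816 : ℝ) / 3125 * pointLaw 10 h := by
  have e : blobLaw [(5, (68 : ℝ) / 125)] = fun k => (1 - (68 : ℝ) / 125) * pointLaw 0 k + (68 : ℝ) / 125 * pointLaw 5 k :=
    funext fun k => blobLaw_one_apply 5 _ k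
  simp only [blobLaw] at e ⊢
  rw [e, slice_apply_lin2]
  norm_num
  ring

/-- column 3: `blob(1, 12/25) ∗ δ₁ ∗ blob(4, 91/100)` = `blobLaw [(1, 12/25), (4, 91/100), (1, 1)]`. [this work] -/
theorem cw3_apply (h : ℕ) : blobLaw [(1, (12 : ℝ) / 25), (4, (91 : ℝ) / 100), (1, 1)] h =
    (117 : ℝ) / 2500 * pointLaw 1 h + (27 : ℝ) / 625 * pointLaw 2 h + (1183 : ℝ) / 2500 * pointLaw 5 h + (273 : ℝ) / 625 * pointLaw 6 h := by
  have e : blobLaw [(4, (91 : ℝ) / 100), (1, 1)] = fun k => (1 - (91 : ℝ) / 100) * pointLaw 1 k + (91 : ℝ) / 100 * pointLaw (4 + 1) k :=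
    funext fun k => blobLaw_pair_sure_apply 4 1 _ k
  show slice (blobLaw [(4, (91 : ℝ) / 100), (1, 1)]) 1 ((12 : ℝ) / 25) h = _
  rw [e, slice_apply_lin2]
  norm_num
  ring

/-- column 4: `blob(5, 12/25) ∗ gate_{136/175}(δ₁ ∗ blob(4, 5/8))`. [this work] -/
theorem cw4_apply (h : ℕ) : slice (gate (blobLaw [(4, (5 : ℝ) / 8), (1, 1)]) ((136 : ℝ) / 175)) 5 ((12 : ℝ) / 25) h =
    (507 : ℝ) / 4375 * pointLaw 0 h + (663 : ℝ) / 4375 * pointLaw 1 h + (1573 : ℝ) / 4375 * pointLaw 5 h + (612 : ℝ) / 4375 * pointLaw 6 h +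
      (204 : ℝ) / 875 * pointLaw 10 h := by
  have e : gate (blobLaw [(4, (5 : ℝ) / 8), (1, 1)]) ((136 : ℝ) / 175) = fun k =>
      (1 - (136 : ℝ) / 175) * pointLaw 0 k + (136 : ℝ) / 175 * (1 - (5 : ℝ) / 8) * pointLaw 1 k + (136 : ℝ) / 175 * ((5 : ℝ) / 8) * pointLaw (4 + 1) k := by
    funext k
    rw [gate_apply, blobLaw_pair_sure_apply, show (if k = 0 then (1 : ℝ) else 0) = pointLaw 0 k from (pointLaw_apply 0 k).symm]
    ring
  rw [e, slice_apply_lin3]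
  norm_num
  ring

/-- column 5: `δ₂ ∗ gate_{7/8}(δ₃ ∗ blob(1, 99/175))`. [this work] -/
theorem cw5_apply (h : ℕ) : slice (gate (blobLaw [(1, (99 : ℝ) / 175), (3, 1)]) ((7 : ℝ) / 8)) 2 1 h =
    (1 : ℝ) / 8 * pointLaw 2 h + (19 : ℝ) / 50 * pointLaw 5 h + (99 : ℝ) / 200 * pointLaw 6 h := by
  have e : gate (blobLaw [(1, (99 : ℝ) / 175), (3, 1)]) ((7 : ℝ) / 8) = fun k =>
      (1 - (7 : ℝ) / 8) * pointLaw 0 k + (7 : ℝ) / 8 * (1 - (99 : ℝ) / 175) * pointLaw 3 k + (7 : ℝ) / 8 * ((99 : ℝ) / 175) * pointLaw (1 + 3) k := by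
    funext k
    rw [gate_apply, blobLaw_pair_sure_apply, show (if k = 0 then (1 : ℝ) else 0) = pointLaw 0 k from (pointLaw_apply 0 k).symm]
    ring
  rw [e, slice_apply_lin3]
  norm_num

/-- **THE CERTIFICATE IDENTITY** at the floor `12/25` (pointwise). [this work] -/
theorem cornerLaw_eq_mix (h : ℕ) : lpT 4 (3 / 5) (49 / 60) h =
    (1789 : ℝ) / 33024 * gate (blobLaw [(8, (3 : ℝ) / 4), (2, 1)]) ((16 : ℝ) / 25) h +
      (1158685 : ℝ) / 3649152 * blobLaw [(5, (12 : ℝ) / 25), (5, (68 : ℝ) / 125)] h +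
      (6259 : ℝ) / 107328 * blobLaw [(1, (12 : ℝ) / 25), (4, (91 : ℝ) / 100), (1, 1)] h +
      (4106641 : ℝ) / 7298304 * slice (gate (blobLaw [(4, (5 : ℝ) / 8), (1, 1)]) ((136 : ℝ) / 175)) 5 ((12 : ℝ) / 25) h +
      (49 : ℝ) / 6708 * slice (gate (blobLaw [(1, (99 : ℝ) / 175), (3, 1)]) ((7 : ℝ) / 8)) 2 1 h := by
  rw [lpT_apply, cw1_apply, cw2_apply, cw3_apply, cw4_apply, cw5_apply]
  norm_num
  ring

/-! ### Membership -/

/-- **THE CORNER LAW IS IN THE HULL AT FLOOR `12/25`**: `InGatedCatHull (12/25) (128/25) 10 (lpT 4 (3/5) (49/60))`. [this work] -/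
theorem cornerLaw_inGatedCatHull : InGatedCatHull ((12 : ℝ) / 25) ((128 : ℝ) / 25) 10 (lpT 4 (3 / 5) (49 / 60)) := by
  have hy0 : (0 : ℝ) < 12 / 25 := by norm_num
  have hy1 : (12 : ℝ) / 25 < 1 := by norm_num
  -- column 1: `gate_{16/25}` of the blob forest `δ₂ ∗ blob(8, 3/4)` at floor `3/4`
  have m1 : InGatedCatHull ((12 : ℝ) / 25) ((128 : ℝ) / 25) 10 (gate (blobLaw [(8, (3 : ℝ) / 4), (2, 1)]) ((16 : ℝ) / 25)) := by
    have g := inGatedCatHull_blobLaw ((3 : ℝ) / 4) (by norm_num) (by norm_num) [(8, (3 : ℝ) / 4), (2, 1)] (fun p hp => by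
      simp only [List.mem_cons, List.not_mem_nil, or_false] at hp
      rcases hp with rfl | rfl <;> norm_num) (M := 10) (by simp only [blobTop]; omega)
    have g2 := inGatedCatHull_gate g (by norm_num) ((16 : ℝ) / 25) (by norm_num) (by norm_num)
    have e1 : (16 : ℝ) / 25 * (3 / 4) = 12 / 25 := by norm_num
    have e2 : (16 : ℝ) / 25 * blobMean [(8, (3 : ℝ) / 4), (2, 1)] = 128 / 25 := by simp only [blobMean]; push_cast; norm_num
    rwa [e1, e2] at g2
  -- column 2: blob forest at floor `12/25`
  have m2 : InGatedCatHull ((12 : ℝ) / 25) ((128 : ℝ) / 25) 10 (blobLaw [(5, (12 : ℝ) / 25), (5, (68 : ℝ) / 125)]) := by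
    have g := inGatedCatHull_blobLaw ((12 : ℝ) / 25) hy0 hy1 [(5, (12 : ℝ) / 25), (5, (68 : ℝ) / 125)] (fun p hp => by
      simp only [List.mem_cons, List.not_mem_nil, or_false] at hp
      rcases hp with rfl | rfl <;> norm_num) (M := 10) (by simp only [blobTop]; omega)
    have e : blobMean [(5, (12 : ℝ) / 25), (5, (68 : ℝ) / 125)] = 128 / 25 := by simp only [blobMean]; push_cast; norm_num
    rwa [e] at g
  -- column 3: blob forest at floor `12/25`
  have m3 : InGatedCatHull ((12 : ℝ) / 25) ((128 : ℝ) / 25) 10 (blobLaw [(1, (12 : ℝ) / 25), (4, (91 : ℝ) / 100), (1, 1)]) := by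
    have g := inGatedCatHull_blobLaw ((12 : ℝ) / 25) hy0 hy1 [(1, (12 : ℝ) / 25), (4, (91 : ℝ) / 100), (1, 1)] (fun p hp => by
      simp only [List.mem_cons, List.not_mem_nil, or_false] at hp
      rcases hp with rfl | rfl | rfl <;> norm_num) (M := 10) (by simp only [blobTop]; omega)
    have e : blobMean [(1, (12 : ℝ) / 25), (4, (91 : ℝ) / 100), (1, 1)] = 128 / 25 := by simp only [blobMean]; push_cast; norm_num
    rwa [e] at g
  -- column 4: the caterpillar `blob(5,12/25) ∗ gate_{136/175}(δ₁ ∗ blob(4,5/8))` (inner floor `21/34`)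
  have m4 : InGatedCatHull ((12 : ℝ) / 25) ((128 : ℝ) / 25) 10
      (slice (gate (blobLaw [(4, (5 : ℝ) / 8), (1, 1)]) ((136 : ℝ) / 175)) 5 ((12 : ℝ) / 25)) := by
    have g := inGatedCatHull_blobLaw ((21 : ℝ) / 34) (by norm_num) (by norm_num) [(4, (5 : ℝ) / 8), (1, 1)] (fun p hp => by
      simp only [List.mem_cons, List.not_mem_nil, or_false] at hp
      rcases hp with rfl | rfl <;> norm_num) (M := 5) (by simp only [blobTop]; omega)
    have g2 := inGatedCatHull_gate g (by norm_num) ((136 : ℝ) / 175) (by norm_num) (by norm_num)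
    have e1 : (136 : ℝ) / 175 * (21 / 34) = 12 / 25 := by norm_num
    rw [e1] at g2
    have g3 := inGatedCatHull_slice g2 hy0 5 ((12 : ℝ) / 25) le_rfl (by norm_num)
    have e2 : (136 : ℝ) / 175 * blobMean [(4, (5 : ℝ) / 8), (1, 1)] + ((5 : ℕ) : ℝ) * (12 / 25) = 128 / 25 := by
      simp only [blobMean]; push_cast; norm_num
    rwa [e2] at g3
  -- column 5: the caterpillar `δ₂ ∗ gate_{7/8}(δ₃ ∗ blob(1, 99/175))` (inner floor `96/175`)
  have m5 : InGatedCatHull ((12 : ℝ) / 25) ((128 : ℝ) / 25) 10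
      (slice (gate (blobLaw [(1, (99 : ℝ) / 175), (3, 1)]) ((7 : ℝ) / 8)) 2 1) := by
    have g := inGatedCatHull_blobLaw ((96 : ℝ) / 175) (by norm_num) (by norm_num) [(1, (99 : ℝ) / 175), (3, 1)] (fun p hp => by
      simp only [List.mem_cons, List.not_mem_nil, or_false] at hp
      rcases hp with rfl | rfl <;> norm_num) (M := 4) (by simp only [blobTop]; omega)
    have g2 := inGatedCatHull_gate g (by norm_num) ((7 : ℝ) / 8) (by norm_num) (by norm_num)
    have e1 : (7 : ℝ) / 8 * (96 / 175) = 12 / 25 := by norm_num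
    rw [e1] at g2
    have g3 := inGatedCatHull_slice g2 hy0 2 1 hy1.le le_rfl
    have e2 : (7 : ℝ) / 8 * blobMean [(1, (99 : ℝ) / 175), (3, 1)] + ((2 : ℕ) : ℝ) * 1 = 128 / 25 := by
      simp only [blobMean]; push_cast; norm_num
    rw [e2] at g3
    exact g3.mono_top (by norm_num)
  exact InGatedCatHull.mix5 ((1789 : ℝ) / 33024) ((1158685 : ℝ) / 3649152) ((6259 : ℝ) / 107328) ((4106641 : ℝ) / 7298304)
    ((49 : ℝ) / 6708) (by norm_num) (by norm_num) (by norm_num) (by norm_num) (by norm_num) (by norm_num) m1 m2 m3 m4 m5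
    cornerLaw_eq_mix

/-- **SDEC at the floor `12/25`** (no oracle). [this work] -/
theorem sdec_cornerLaw : SDEC ((12 : ℝ) / 25) 10 (lpT 4 (3 / 5) (49 / 60)) :=
  sdec_of_inGatedCatHull (by norm_num) cornerLaw_inGatedCatHull

/-- **the node's instances for this law at floors `≤ 12/25`**: every tree-built presentation `TreeBuilt x M (lpT 4 (3/5) (49/60))` with `x ≤ 12/25` is in the
hull at `x`, its own mean and top. [this work] -/
theorem treeBuiltCatHull_cornerLaw (x : ℝ) (M : ℕ) (hTB : TreeBuilt x M (lpT 4 (3 / 5) (49 / 60))) (hx : x ≤ 12 / 25) :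
    InGatedCatHull x (∑ h ∈ Finset.range (M + 1), (h : ℝ) * lpT 4 (3 / 5) (49 / 60) h) M (lpT 4 (3 / 5) (49 / 60)) := by
  obtain ⟨hx0, hM⟩ := lpT_treeBuilt_top 4 (3 / 5) (49 / 60) (by norm_num) (by norm_num) (by norm_num) (by norm_num) hTB
  obtain ⟨a, rfl⟩ := Nat.exists_eq_add_of_le hM
  rw [sum_range_extend (fun h => (h : ℝ) * lpT 4 (3 / 5) (49 / 60) h) (2 * 4 + 2) a
      (fun h hh => by rw [lpT_eq_zero 4 (3 / 5) (49 / 60) h hh, mul_zero]), lpT_mean]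
  have e : 2 * (3 / 5 : ℝ) * (1 + (4 : ℕ) * (49 / 60 : ℝ)) = 128 / 25 := by norm_num
  rw [e]
  exact (cornerLaw_inGatedCatHull.mono hx0 hx).mono_top hM

end LawDec
end Quant
end Summit.CriticalPhenomena.PercolationContinuityZ3.Theorems
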